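import Literature.Analysis.FluidPDE.NSVorticityEnergy
import Literature.Analysis.FluidPDE.WholeSpaceIBP
import Literature.Analysis.FluidPDE.TaoLocalisationProofs
import Literature.Analysis.FunctionSpaces.SobolevImbeddingSup
import HarnessLib

/-!
# Constantin's small-viscosity comparison theorem, I: calculus tools

Analysis/FluidPDE support file (theorems only, no definitions, no named facts), the first of the
files proving the named fact `Literature.Analysis.FluidPDE.constantin_small_viscosity`
(`ConstantinSmallViscosity.lean`; P. Constantin, *Note on loss of regularity for solutions of the
3-D incompressible Euler and related equations*, Comm. Math. Phys. 104 (1986), Thm. 1.1: as long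
as the Euler solution is smooth, the slightly viscous Navier–Stokes solution with the same datum
is smooth, with `sup_t ‖u − v‖_m ≤ Cν`). The proof formalised in this series is Constantin's:
the `H^m` energy inequality (1.10) for the difference `w = u − v` (Kato's estimates (1.8)–(1.9)),
the ODE lemma 1.3, and continuation by the local `H^m` theory — run in the tree's coordinate
calculus (`CoordDerivatives`: `pderiv`, `ipderiv`, `dnorm`, `levelSq`) with the cutoffs `χ_R` of
`WholeSpaceIBP`, as in the tree's Beale–Kato–Majda files.

This file collects the elementary tools:

* `integral_pderiv_eq_zero`, `integral_ipderiv_mul_eq` — no boundary terms on the whole space and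
  iterated integration by parts along a word against a compactly supported function;
* `abs_ipderiv_mul_le` — the full Leibniz bound `|∂^γ(fg)| ≤ 2^m ∑_{a ≤ m} |∇ᵃf| |∇^{m-a}g|`
  (from the tree's remainder bound `abs_ipderiv_mul_sub_mul_ipderiv_le`);
* `exists_norm_iteratedFDeriv_cutoff_le_div_pow`, `exists_dnorm_cutoff_le_of_le`,
  `exists_abs_pderiv_cutoff_le_div` — all derivatives of order `k ≥ 1` of `χ_R` are `O(1/R)`
  for `R ≥ 1` (`χ_R = χ(·/R)`);
* `exists_abs_le_sobolev_dnormSq` — the Sobolev imbedding `W^{2,2}(ℝ³) ⊂ C_B(ℝ³)` in coordinate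
  form, from the tree's `FunctionSpaces.exists_enorm_le_sobolev_two_two_dim_three`
  (Adams 1975, Thm. 5.4);
* `integral_le_of_abs_le_mul`, `integral_le_of_abs_le_mul_mul`, `integrable_of_abs_le_mul` —
  drop-in Cauchy–Schwarz bounds `∫ F ≤ C‖f‖₂‖g‖₂` for `|F| ≤ C|f||g|` (no integrability of `F`
  needed), and `L²` bookkeeping for `∂^β f`, `|∇^m f|`.

## Mathlib / tree search

Tree (used): `integral_mul_pderiv_eq_neg`, `integral_fderiv_apply_eq_zero` (`NSVorticityEnergy`,
`WholeSpaceIBP`), `abs_ipderiv_mul_sub_mul_ipderiv_le`, `abs_ipderiv_le_norm_iteratedFDeriv`,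
`sq_norm_iteratedFDeriv_le_card_pow_mul_dnormSq`, `dnorm_ipderiv_le` (`CoordDerivatives`),
`cutoff`, `contDiff_cutoff` (`WholeSpaceIBP`), `eLpNorm_two_le_rpow_of_lintegral_sq_le`
(`TaoLocalisationProofs`), `integral_mul_le_sqrt_mul_sqrt_of_memLp` (`EnergyToolkit`),
`FunctionSpaces.exists_enorm_le_sobolev_two_two_dim_three` (`SobolevImbeddingSup`). Mathlib:
`ContinuousLinearMap.iteratedFDeriv_comp_right`,
`ContinuousMultilinearMap.norm_compContinuousLinearMap_le`, `MemLp.integrable_mul`,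
`memLp_two_iff_integrable_sq`, `integral_undef`. No existing `integral_ipderiv_mul_eq` /
higher-order cutoff bounds (`lean search 'iteratedFDeriv_cutoff|ipderiv_mul_eq'`: none).

## References

* P. Constantin, Comm. Math. Phys. 104 (1986), 311–326, §1. [Constantin1986]
* R. A. Adams, *Sobolev Spaces* (1975), Thm. 5.4 Part I Case C. [Adams1975]
-/

noncomputable section

open MeasureTheory Set Function Filter Finset
open scoped ENNReal NNReal ContDiff BigOperators

namespace Literature.Analysis.FluidPDE

section IBP

variable {ι : Type*} [Fintype ι] [DecidableEq ι]

/-- **No boundary terms**: `∫ ∂ₗ h = 0` for `h ∈ C¹_c(ℝ^ι)` (the coordinate form of the tree's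
`integral_fderiv_apply_eq_zero`). [folklore] -/
theorem integral_pderiv_eq_zero {h : EuclideanSpace ℝ ι → ℝ} (hh : ContDiff ℝ 1 h)
    (hc : HasCompactSupport h) (l : ι) : ∫ x, pderiv l h x = 0 := by
  simp only [pderiv_apply]
  exact integral_fderiv_apply_eq_zero hh hc _

omit [Fintype ι] in
/-- Partial derivatives of a compactly supported function are compactly supported. [folklore] -/
theorem pderiv_hasCompactSupport {h : EuclideanSpace ℝ ι → ℝ} (hc : HasCompactSupport h) (l : ι) :
    HasCompactSupport (pderiv l h) := by
  rw [pderiv_eq]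
  exact hc.fderiv_apply (𝕜 := ℝ) (stdVec l)

omit [Fintype ι] in
/-- Word derivatives of a compactly supported smooth function are compactly supported. [folklore] -/
theorem ipderiv_hasCompactSupport {h : EuclideanSpace ℝ ι → ℝ} (hc : HasCompactSupport h) :
    ∀ {m : ℕ} (γ : Fin m → ι), HasCompactSupport (ipderiv γ h)
  | 0, _ => hc
  | _ + 1, γ => by
      rw [ipderiv_succ]
      exact pderiv_hasCompactSupport (ipderiv_hasCompactSupport hc (Fin.tail γ)) (γ 0)

/-- **Iterated integration by parts along a word**: for smooth `f` and smooth compactly supported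
`g`, `∫ (∂^γ f) g = (-1)^{|γ|} ∫ f (∂^γ g)` (one `integral_mul_pderiv_eq_neg` per letter; the
order of the letters on `g` is immaterial since mixed partials of smooth functions commute,
`pderiv_ipderiv`). [folklore] -/
theorem integral_ipderiv_mul_eq {f : EuclideanSpace ℝ ι → ℝ} (hf : ContDiff ℝ ∞ f) :
    ∀ {m : ℕ} (γ : Fin m → ι) {g : EuclideanSpace ℝ ι → ℝ}, ContDiff ℝ ∞ g → HasCompactSupport g →
      ∫ x, ipderiv γ f x * g x = (-1) ^ m * ∫ x, f x * ipderiv γ g x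
  | 0, γ, g, _, _ => by simp
  | m + 1, γ, g, hg, hgc => by
      have hF : ContDiff ℝ ∞ (ipderiv (Fin.tail γ) f) := contDiff_ipderiv hf _
      have h1 : ∫ x, pderiv (γ 0) (ipderiv (Fin.tail γ) f) x * g x =
          -∫ x, ipderiv (Fin.tail γ) f x * pderiv (γ 0) g x := by
        have h := integral_mul_pderiv_eq_neg (ψ := g) (g := ipderiv (Fin.tail γ) f)
          (hg.of_le (by exact_mod_cast le_top)) hgc (hF.of_le (by exact_mod_cast le_top)) (γ 0)
        have e1 : ∫ x, pderiv (γ 0) (ipderiv (Fin.tail γ) f) x * g x =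
            ∫ x, g x * pderiv (γ 0) (ipderiv (Fin.tail γ) f) x :=
          integral_congr_ae (Eventually.of_forall fun x => mul_comm _ _)
        have e2 : ∫ x, ipderiv (Fin.tail γ) f x * pderiv (γ 0) g x =
            ∫ x, pderiv (γ 0) g x * ipderiv (Fin.tail γ) f x :=
          integral_congr_ae (Eventually.of_forall fun x => mul_comm _ _)
        rw [e1, e2]
        exact h
      rw [ipderiv_succ, h1, integral_ipderiv_mul_eq hf (Fin.tail γ) (contDiff_pderiv hg (γ 0))
        (pderiv_hasCompactSupport hgc (γ 0)), ← pderiv_ipderiv hg (γ 0) (Fin.tail γ), ← ipderiv_succ]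
      rw [pow_succ]
      ring

end IBP

section Leibniz

variable {ι : Type*} [Fintype ι] [DecidableEq ι]

/-- `|f x| = |∇⁰ f (x)|`. [folklore] -/
theorem abs_eq_dnorm_zero (f : EuclideanSpace ℝ ι → ℝ) (x : EuclideanSpace ℝ ι) : |f x| = dnorm 0 f x :=
  (dnorm_zero f x).symm

/-- **Full Leibniz bound** along a word of length `m`:
`|∂^γ (f g)(x)| ≤ 2^m ∑_{a=0}^{m} |∇^a f (x)| |∇^{m-a} g (x)|` (the remainder bound
`abs_ipderiv_mul_sub_mul_ipderiv_le` plus the leading term `|f ∂^γ g| ≤ |∇⁰f| |∇^m g|`). [folklore] -/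
theorem abs_ipderiv_mul_le {f g : EuclideanSpace ℝ ι → ℝ} (hf : ContDiff ℝ ∞ f) (hg : ContDiff ℝ ∞ g)
    {m : ℕ} (γ : Fin m → ι) (x : EuclideanSpace ℝ ι) :
    |ipderiv γ (fun y => f y * g y) x| ≤
      2 ^ m * ∑ a ∈ Finset.range (m + 1), dnorm a f x * dnorm (m - a) g x := by
  have hrem := abs_ipderiv_mul_sub_mul_ipderiv_le hf hg γ x
  have hlead : |f x * ipderiv γ g x| ≤ dnorm 0 f x * dnorm m g x := by
    rw [abs_mul, ← dnorm_zero f x]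
    exact mul_le_mul_of_nonneg_left (abs_ipderiv_le_dnorm γ g x) (dnorm_nonneg _ _ _)
  have hnn : ∀ a, 0 ≤ dnorm a f x * dnorm (m - a) g x := fun a =>
    mul_nonneg (dnorm_nonneg _ _ _) (dnorm_nonneg _ _ _)
  have hsplit : ∑ a ∈ Finset.range (m + 1), dnorm a f x * dnorm (m - a) g x =
      dnorm 0 f x * dnorm m g x + ∑ a ∈ Finset.Icc 1 m, dnorm a f x * dnorm (m - a) g x := by
    rw [Finset.range_eq_Ico, Finset.sum_eq_sum_Ico_succ_bot (Nat.succ_pos m), Nat.sub_zero]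
    congr 1
  have h2m : (1 : ℝ) ≤ 2 ^ m := one_le_pow₀ (by norm_num)
  calc |ipderiv γ (fun y => f y * g y) x|
      = |(ipderiv γ (fun y => f y * g y) x - f x * ipderiv γ g x) + f x * ipderiv γ g x| := by
        rw [sub_add_cancel]
    _ ≤ |ipderiv γ (fun y => f y * g y) x - f x * ipderiv γ g x| + |f x * ipderiv γ g x| :=
        abs_add_le _ _
    _ ≤ 2 ^ m * ∑ a ∈ Finset.Icc 1 m, dnorm a f x * dnorm (m - a) g x + dnorm 0 f x * dnorm m g x :=
        add_le_add hrem hlead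
    _ ≤ 2 ^ m * ∑ a ∈ Finset.Icc 1 m, dnorm a f x * dnorm (m - a) g x +
          2 ^ m * (dnorm 0 f x * dnorm m g x) := by
        refine add_le_add le_rfl ?_
        exact le_mul_of_one_le_left (hnn 0) h2m
    _ = 2 ^ m * ∑ a ∈ Finset.range (m + 1), dnorm a f x * dnorm (m - a) g x := by
        rw [hsplit]; ring

/-- `|∇^a (f + g)| ≤ |∇^a f| + |∇^a g|` restated for the difference `f = (f - g) + g`:
`|∇^a f (x)| ≤ |∇^a (f - g)(x)| + |∇^a g (x)|`. [folklore] -/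
theorem dnorm_le_dnorm_sub_add {f g : EuclideanSpace ℝ ι → ℝ} (hf : ContDiff ℝ ∞ f) (hg : ContDiff ℝ ∞ g)
    (a : ℕ) (x : EuclideanSpace ℝ ι) :
    dnorm a f x ≤ dnorm a (fun y => f y - g y) x + dnorm a g x := by
  have h := dnorm_add_le (hf.sub hg) hg a x
  have e : (fun y => (f y - g y) + g y) = f := funext fun y => sub_add_cancel _ _
  simpa [e] using h

end Leibniz


section CutoffDerivs

variable {ι : Type*} [Fintype ι] [DecidableEq ι]

omit [DecidableEq ι] in
/-- **All derivatives of the cut-off at scale `R` are `O(R^{-k})`**: `‖Dᵏ χ_R (x)‖ ≤ A_k / Rᵏ`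
for `R > 0`, since `χ_R = χ(·/R)` for the fixed bump `χ` whose derivatives are bounded (smooth
with compact support) and `Dᵏ(χ ∘ L) = (Dᵏχ ∘ L)(L·, …, L·)` for the linear map `L = R⁻¹ id`. [folklore] -/
theorem exists_norm_iteratedFDeriv_cutoff_le_div_pow (k : ℕ) :
    ∃ A : ℝ, 0 ≤ A ∧ ∀ R : ℝ, 0 < R → ∀ x : EuclideanSpace ℝ ι,
      ‖iteratedFDeriv ℝ k (cutoff R) x‖ ≤ A / R ^ k := by
  obtain ⟨A, hA⟩ :=
    ((FunctionSpaces.dyadicCutoff (EuclideanSpace ℝ ι)).hasCompactSupport.iteratedFDeriv k).exists_bound_of_continuous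
      ((FunctionSpaces.dyadicCutoff (EuclideanSpace ℝ ι)).contDiff.continuous_iteratedFDeriv
        (mod_cast le_top))
  refine ⟨max A 0, le_max_right _ _, fun R hR x => ?_⟩
  set L : EuclideanSpace ℝ ι →L[ℝ] EuclideanSpace ℝ ι := R⁻¹ • ContinuousLinearMap.id ℝ _ with hL
  have hfun : cutoff (E := EuclideanSpace ℝ ι) R =
      ⇑(FunctionSpaces.dyadicCutoff (EuclideanSpace ℝ ι)) ∘ ⇑L := by
    funext y; rfl
  rw [hfun, L.iteratedFDeriv_comp_right (FunctionSpaces.dyadicCutoff (EuclideanSpace ℝ ι)).contDiff x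
    (mod_cast le_top)]
  have hR' : 0 ≤ R⁻¹ := inv_nonneg.2 hR.le
  have hLn : ‖L‖ ≤ R⁻¹ := by
    rw [hL, norm_smul, Real.norm_of_nonneg hR']
    exact (mul_le_mul_of_nonneg_left ContinuousLinearMap.norm_id_le hR').trans (mul_one _).le
  calc ‖(iteratedFDeriv ℝ k (⇑(FunctionSpaces.dyadicCutoff (EuclideanSpace ℝ ι))) (L x)).compContinuousLinearMap
        fun _ => L‖
      ≤ ‖iteratedFDeriv ℝ k (⇑(FunctionSpaces.dyadicCutoff (EuclideanSpace ℝ ι))) (L x)‖ *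
          ∏ _j : Fin k, ‖L‖ :=
        ContinuousMultilinearMap.norm_compContinuousLinearMap_le _ _
    _ ≤ max A 0 * (R⁻¹) ^ k := by
        rw [Finset.prod_const, Finset.card_univ, Fintype.card_fin]
        have h1 : ‖iteratedFDeriv ℝ k (⇑(FunctionSpaces.dyadicCutoff (EuclideanSpace ℝ ι))) (L x)‖ ≤
            max A 0 :=
          (hA _).trans (le_max_left _ _)
        have h2 : ‖L‖ ^ k ≤ (R⁻¹) ^ k := pow_le_pow_left₀ (norm_nonneg _) hLn k
        exact mul_le_mul h1 h2 (pow_nonneg (norm_nonneg _) _) (le_max_right _ _)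
    _ = max A 0 / R ^ k := by rw [inv_pow, div_eq_mul_inv]

/-- `|∂^γ χ_R (x)| ≤ A_k / R` for words of length `k ≥ 1` and `R ≥ 1`. [folklore] -/
theorem exists_abs_ipderiv_cutoff_le {k : ℕ} (hk : 1 ≤ k) :
    ∃ A : ℝ, 0 ≤ A ∧ ∀ R : ℝ, 1 ≤ R → ∀ (γ : Fin k → ι) (x : EuclideanSpace ℝ ι),
      |ipderiv γ (cutoff R) x| ≤ A / R := by
  obtain ⟨A, hA0, hA⟩ := exists_norm_iteratedFDeriv_cutoff_le_div_pow (ι := ι) k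
  refine ⟨A, hA0, fun R hR γ x => ?_⟩
  have hR0 : 0 < R := by linarith
  calc |ipderiv γ (cutoff R) x| ≤ ‖iteratedFDeriv ℝ k (cutoff R) x‖ :=
        abs_ipderiv_le_norm_iteratedFDeriv (contDiff_cutoff R) γ x
    _ ≤ A / R ^ k := hA R hR0 x
    _ ≤ A / R := by
        refine div_le_div_of_nonneg_left hA0 hR0 ?_
        calc R = R ^ 1 := (pow_one R).symm
          _ ≤ R ^ k := pow_le_pow_right₀ hR hk

/-- `|∇^k f (x)| ≤ ∑_γ |∂^γ f (x)|` (`√(∑ a²) ≤ ∑ |a|`). [folklore] -/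
theorem dnorm_le_sum_abs_ipderiv (k : ℕ) (f : EuclideanSpace ℝ ι → ℝ) (x : EuclideanSpace ℝ ι) :
    dnorm k f x ≤ ∑ γ : Fin k → ι, |ipderiv γ f x| := by
  rw [dnorm, dnormSq]
  refine Real.sqrt_le_iff.2 ⟨Finset.sum_nonneg fun _ _ => abs_nonneg _, ?_⟩
  calc ∑ γ : Fin k → ι, ipderiv γ f x ^ 2 = ∑ γ : Fin k → ι, |ipderiv γ f x| ^ 2 :=
        Finset.sum_congr rfl fun γ _ => (sq_abs _).symm
    _ ≤ (∑ γ : Fin k → ι, |ipderiv γ f x|) ^ 2 :=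
        Finset.sum_sq_le_sq_sum_of_nonneg fun γ _ => abs_nonneg _

/-- **Coordinate derivative bounds of the cut-off**: `|∇^k χ_R (x)| ≤ A_k / R` for `k ≥ 1`,
`R ≥ 1`. [folklore] -/
theorem exists_dnorm_cutoff_le {k : ℕ} (hk : 1 ≤ k) :
    ∃ A : ℝ, 0 ≤ A ∧ ∀ R : ℝ, 1 ≤ R → ∀ x : EuclideanSpace ℝ ι, dnorm k (cutoff R) x ≤ A / R := by
  obtain ⟨A, hA0, hA⟩ := exists_abs_ipderiv_cutoff_le (ι := ι) hk
  refine ⟨(Fintype.card (Fin k → ι) : ℝ) * A, by positivity, fun R hR x => ?_⟩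
  calc dnorm k (cutoff R) x ≤ ∑ γ : Fin k → ι, |ipderiv γ (cutoff R) x| :=
        dnorm_le_sum_abs_ipderiv k _ x
    _ ≤ ∑ _γ : Fin k → ι, A / R := Finset.sum_le_sum fun γ _ => hA R hR γ x
    _ = (Fintype.card (Fin k → ι) : ℝ) * A / R := by
        rw [Finset.sum_const, Finset.card_univ, nsmul_eq_mul, mul_div_assoc]

/-- **Uniform coordinate derivative bounds of the cut-off up to a given order**: one constant
`A` with `|∇^k χ_R (x)| ≤ A / R` for all `1 ≤ k ≤ N`, `R ≥ 1`. [folklore] -/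
theorem exists_dnorm_cutoff_le_of_le (N : ℕ) :
    ∃ A : ℝ, 0 ≤ A ∧ ∀ R : ℝ, 1 ≤ R → ∀ k, 1 ≤ k → k ≤ N →
      ∀ x : EuclideanSpace ℝ ι, dnorm k (cutoff R) x ≤ A / R := by
  have h : ∀ k : ℕ, ∃ A : ℝ, 0 ≤ A ∧ (1 ≤ k → ∀ R : ℝ, 1 ≤ R →
      ∀ x : EuclideanSpace ℝ ι, dnorm k (cutoff R) x ≤ A / R) := by
    intro k
    by_cases hk : 1 ≤ k
    · obtain ⟨A, hA0, hA⟩ := exists_dnorm_cutoff_le (ι := ι) hk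
      exact ⟨A, hA0, fun _ => hA⟩
    · exact ⟨0, le_rfl, fun h => absurd h hk⟩
  choose A hA0 hA using h
  refine ⟨∑ k ∈ Finset.range (N + 1), A k, Finset.sum_nonneg fun k _ => hA0 k,
    fun R hR k hk1 hkN x => ?_⟩
  have hR0 : 0 < R := by linarith
  refine (hA k hk1 R hR x).trans (div_le_div_of_nonneg_right ?_ hR0.le)
  exact Finset.single_le_sum (f := A) (fun k _ => hA0 k) (Finset.mem_range.2 (Nat.lt_succ_of_le hkN))

/-- The first-order case in the shape used for the transport and viscous cutoff errors:
`|∂ₗ χ_R (x)| ≤ A / R` for `R ≥ 1`. [folklore] -/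
theorem exists_abs_pderiv_cutoff_le_div :
    ∃ A : ℝ, 0 ≤ A ∧ ∀ R : ℝ, 1 ≤ R → ∀ (l : ι) (x : EuclideanSpace ℝ ι), |pderiv l (cutoff R) x| ≤ A / R := by
  obtain ⟨A, hA0, hA⟩ := exists_abs_ipderiv_cutoff_le (ι := ι) (k := 1) le_rfl
  refine ⟨A, hA0, fun R hR l x => ?_⟩
  have h := hA R hR (fun _ => l) x
  rwa [ipderiv_succ, ipderiv_zero] at h

end CutoffDerivs

section SobolevSup

/-- **Sobolev sup bound in coordinates** (`W^{2,2}(ℝ³) ⊂ C_B(ℝ³)`, Adams 1975, Thm. 5.4 Part I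
Case C; tree `FunctionSpaces.exists_enorm_le_sobolev_two_two_dim_three`): there is an absolute
`K ≥ 0` such that for every smooth scalar `f` on `ℝ³` with `|∇ʲf|² ∈ L¹`, `j ≤ 2`,
`|f(x)| ≤ K ∑_{j<3} (∫ |∇ʲ f|²)^{1/2}`. [cite: Adams1975, Thm. 5.4 Part I Case C (mp > n)] -/
theorem exists_abs_le_sobolev_dnormSq :
    ∃ K : ℝ, 0 ≤ K ∧ ∀ f : EuclideanSpace ℝ (Fin 3) → ℝ, ContDiff ℝ ∞ f →
      (∀ j ∈ Finset.range 3, Integrable (dnormSq j f)) →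
      ∀ x, |f x| ≤ K * ∑ j ∈ Finset.range 3, Real.sqrt (∫ y, dnormSq j f y) := by
  obtain ⟨K, hK, hbound⟩ := FunctionSpaces.exists_enorm_le_sobolev_two_two_dim_three
    (E := EuclideanSpace ℝ (Fin 3)) (F := ℝ) (volume : Measure (EuclideanSpace ℝ (Fin 3)))
    finrank_euclideanSpace_fin
  refine ⟨K.toReal * 3, by positivity, fun f hf hint x => ?_⟩
  have hI0 : ∀ j, 0 ≤ ∫ y, dnormSq j f y := fun j => integral_nonneg fun y => dnormSq_nonneg _ _ _
  -- `‖Dʲf‖₂ ≤ 3 (∫|∇ʲf|²)^{1/2}`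
  have hj : ∀ j ∈ Finset.range 3, eLpNorm (iteratedFDeriv ℝ j f) 2 volume ≤
      ENNReal.ofReal (3 * Real.sqrt (∫ y, dnormSq j f y)) := by
    intro j hj
    have hj2 : j ≤ 2 := Nat.lt_succ_iff.1 (Finset.mem_range.1 hj)
    have h1 : ∫⁻ y, ‖iteratedFDeriv ℝ j f y‖ₑ ^ 2 ≤ ENNReal.ofReal (3 ^ j * ∫ y, dnormSq j f y) := by
      calc ∫⁻ y, ‖iteratedFDeriv ℝ j f y‖ₑ ^ 2 = ∫⁻ y, ENNReal.ofReal (‖iteratedFDeriv ℝ j f y‖ ^ 2) :=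
            lintegral_congr fun y => by rw [← ofReal_norm, ENNReal.ofReal_pow (norm_nonneg _)]
        _ ≤ ∫⁻ y, ENNReal.ofReal (3 ^ j * dnormSq j f y) :=
            lintegral_mono fun y => ENNReal.ofReal_le_ofReal (by
              have := sq_norm_iteratedFDeriv_le_card_pow_mul_dnormSq hf j y
              simpa [Fintype.card_fin] using this)
        _ = ENNReal.ofReal (∫ y, 3 ^ j * dnormSq j f y) :=
            (ofReal_integral_eq_lintegral_ofReal ((hint j hj).const_mul _)
              (ae_of_all _ fun y => mul_nonneg (by positivity) (dnormSq_nonneg _ _ _))).symm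
        _ = ENNReal.ofReal (3 ^ j * ∫ y, dnormSq j f y) := by rw [integral_const_mul]
    have h2 := eLpNorm_two_le_rpow_of_lintegral_sq_le h1
    refine h2.trans ?_
    rw [ENNReal.ofReal_rpow_of_nonneg (mul_nonneg (by positivity) (hI0 j)) (by norm_num),
      ← Real.sqrt_eq_rpow, Real.sqrt_mul (by positivity)]
    refine ENNReal.ofReal_le_ofReal (mul_le_mul_of_nonneg_right ?_ (Real.sqrt_nonneg _))
    have h9 : (3 : ℝ) ^ j ≤ 3 ^ 2 := pow_le_pow_right₀ (by norm_num) hj2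
    calc Real.sqrt ((3 : ℝ) ^ j) ≤ Real.sqrt ((3 : ℝ) ^ 2) := Real.sqrt_le_sqrt h9
      _ = 3 := Real.sqrt_sq (by norm_num)
  set S : ℝ := ∑ j ∈ Finset.range 3, Real.sqrt (∫ y, dnormSq j f y) with hS
  have hS0 : 0 ≤ S := Finset.sum_nonneg fun j _ => Real.sqrt_nonneg _
  have h3 : ‖f x‖ₑ ≤ K * ENNReal.ofReal (3 * S) := by
    refine (hbound f (hf.of_le (by norm_cast)) x).trans ?_
    gcongr
    calc ∑ j ∈ Finset.range 3, eLpNorm (iteratedFDeriv ℝ j f) 2 volume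
        ≤ ∑ j ∈ Finset.range 3, ENNReal.ofReal (3 * Real.sqrt (∫ y, dnormSq j f y)) :=
          Finset.sum_le_sum hj
      _ = ENNReal.ofReal (3 * S) := by
          rw [hS, Finset.mul_sum, ENNReal.ofReal_sum_of_nonneg fun j _ => by positivity]
  have hfin : K * ENNReal.ofReal (3 * S) ≠ ⊤ := ENNReal.mul_ne_top hK.ne ENNReal.ofReal_ne_top
  calc |f x| = ‖f x‖ := (Real.norm_eq_abs _).symm
    _ = (‖f x‖ₑ).toReal := (toReal_enorm _).symm
    _ ≤ (K * ENNReal.ofReal (3 * S)).toReal := ENNReal.toReal_mono hfin h3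
    _ = K.toReal * 3 * S := by
        rw [ENNReal.toReal_mul, ENNReal.toReal_ofReal (by positivity), mul_assoc]

end SobolevSup

/-! ## `L²` bookkeeping: drop-in Cauchy–Schwarz bounds and the coordinate tensors in `L²` -/

section L2Helpers

variable {α : Type*} [MeasurableSpace α] {μ : Measure α}

/-- **Drop-in Cauchy–Schwarz bound.** If `|F| ≤ C |f| |g|` pointwise with `f, g ∈ L²` and
`C ≥ 0`, then `∫ F ≤ C ‖f‖₂ ‖g‖₂` — with no integrability hypothesis on `F` (a non-integrable
`F` has Bochner integral `0`). [folklore] -/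
theorem integral_le_of_abs_le_mul {F f g : α → ℝ} (hf : MemLp f 2 μ) (hg : MemLp g 2 μ)
    {C : ℝ} (hC : 0 ≤ C) (h : ∀ x, |F x| ≤ C * (|f x| * |g x|)) :
    ∫ x, F x ∂μ ≤ C * (Real.sqrt (∫ x, f x ^ 2 ∂μ) * Real.sqrt (∫ x, g x ^ 2 ∂μ)) := by
  have hCS : ∫ x, |f x| * |g x| ∂μ ≤ Real.sqrt (∫ x, f x ^ 2 ∂μ) * Real.sqrt (∫ x, g x ^ 2 ∂μ) := by
    have h1 := integral_mul_le_sqrt_mul_sqrt_of_memLp hf.abs hg.abs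
    simpa only [Pi.abs_apply, sq_abs] using h1
  have hprod : Integrable (fun x => |f x| * |g x|) μ := hf.abs.integrable_mul hg.abs
  have h0 : 0 ≤ C * (Real.sqrt (∫ x, f x ^ 2 ∂μ) * Real.sqrt (∫ x, g x ^ 2 ∂μ)) := by positivity
  by_cases hF : Integrable F μ
  · calc ∫ x, F x ∂μ ≤ |∫ x, F x ∂μ| := le_abs_self _
      _ ≤ ∫ x, |F x| ∂μ := abs_integral_le_integral_abs
      _ ≤ ∫ x, C * (|f x| * |g x|) ∂μ := integral_mono hF.abs (hprod.const_mul C) h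
      _ = C * ∫ x, |f x| * |g x| ∂μ := integral_const_mul _ _
      _ ≤ C * (Real.sqrt (∫ x, f x ^ 2 ∂μ) * Real.sqrt (∫ x, g x ^ 2 ∂μ)) :=
          mul_le_mul_of_nonneg_left hCS hC
  · rw [integral_undef hF]
    exact h0

/-- The three-factor version of `integral_le_of_abs_le_mul`: if `|F| ≤ C |h| |f| |g|` with
`|h| ≤ B` and `f, g ∈ L²`, then `∫ F ≤ C B ‖f‖₂ ‖g‖₂`. [folklore] -/
theorem integral_le_of_abs_le_mul_mul {F h f g : α → ℝ} (hf : MemLp f 2 μ) (hg : MemLp g 2 μ)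
    {C B : ℝ} (hC : 0 ≤ C) (hB0 : 0 ≤ B) (hB : ∀ x, |h x| ≤ B)
    (hle : ∀ x, |F x| ≤ C * (|h x| * (|f x| * |g x|))) :
    ∫ x, F x ∂μ ≤ C * B * (Real.sqrt (∫ x, f x ^ 2 ∂μ) * Real.sqrt (∫ x, g x ^ 2 ∂μ)) := by
  refine integral_le_of_abs_le_mul hf hg (mul_nonneg hC hB0) fun x => (hle x).trans ?_
  have h1 : |h x| * (|f x| * |g x|) ≤ B * (|f x| * |g x|) :=
    mul_le_mul_of_nonneg_right (hB x) (by positivity)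
  calc C * (|h x| * (|f x| * |g x|)) ≤ C * (B * (|f x| * |g x|)) := mul_le_mul_of_nonneg_left h1 hC
    _ = C * B * (|f x| * |g x|) := by ring

/-- Integrability from a product bound: `|F| ≤ C |f| |g|` with `f, g ∈ L²` and `F` measurable. [folklore] -/
theorem integrable_of_abs_le_mul {F f g : α → ℝ} (hF : AEStronglyMeasurable F μ) (hf : MemLp f 2 μ)
    (hg : MemLp g 2 μ) {C : ℝ} (h : ∀ x, |F x| ≤ C * (|f x| * |g x|)) : Integrable F μ := by
  have hprod : Integrable (fun x => |f x| * |g x|) μ := hf.abs.integrable_mul hg.abs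
  refine (hprod.const_mul C).mono' hF (Eventually.of_forall fun x => ?_)
  rw [Real.norm_eq_abs]
  exact h x

end L2Helpers

section L2Coord

variable {ι : Type*} [Fintype ι] [DecidableEq ι]

/-- `(∂^β f)² ≤ |∇^m f|²` (one term of the sum). [folklore] -/
theorem ipderiv_sq_le_dnormSq {m : ℕ} (β : Fin m → ι) (f : EuclideanSpace ℝ ι → ℝ) (x : EuclideanSpace ℝ ι) :
    ipderiv β f x ^ 2 ≤ dnormSq m f x :=
  Finset.single_le_sum (f := fun γ : Fin m → ι => ipderiv γ f x ^ 2) (fun _ _ => sq_nonneg _)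
    (Finset.mem_univ β)

/-- A word derivative of a smooth function with `|∇^m f|² ∈ L¹` is in `L²`, with
`∫ (∂^β f)² ≤ ∫ |∇^m f|²`. [folklore] -/
theorem memLp_ipderiv_of_integrable_dnormSq {f : EuclideanSpace ℝ ι → ℝ} (hf : ContDiff ℝ ∞ f) {m : ℕ}
    (β : Fin m → ι) (hI : Integrable (dnormSq m f)) :
    MemLp (ipderiv β f) 2 volume ∧ ∫ x, ipderiv β f x ^ 2 ≤ ∫ x, dnormSq m f x := by
  have hcont : Continuous (ipderiv β f) := continuous_ipderiv hf β
  have hsq : Integrable (fun x => ipderiv β f x ^ 2) :=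
    hI.mono' ((hcont.pow 2).aestronglyMeasurable) (Eventually.of_forall fun x => by
      rw [Real.norm_of_nonneg (sq_nonneg _)]; exact ipderiv_sq_le_dnormSq β f x)
  exact ⟨(memLp_two_iff_integrable_sq hcont.aestronglyMeasurable).2 hsq,
    integral_mono hsq hI fun x => ipderiv_sq_le_dnormSq β f x⟩

/-- The coordinate norm `|∇^m f|` of a smooth function with `|∇^m f|² ∈ L¹` is in `L²`, and
`∫ |∇^m f|² = ∫ dnormSq m f`. [folklore] -/
theorem memLp_dnorm_of_integrable_dnormSq {f : EuclideanSpace ℝ ι → ℝ} (hf : ContDiff ℝ ∞ f) (m : ℕ)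
    (hI : Integrable (dnormSq m f)) :
    MemLp (dnorm m f) 2 volume ∧ ∫ x, dnorm m f x ^ 2 = ∫ x, dnormSq m f x := by
  have hcont : Continuous (dnorm m f) := continuous_dnorm hf m
  have e : (fun x => dnorm m f x ^ 2) = dnormSq m f := funext fun x => dnorm_sq m f x
  refine ⟨(memLp_two_iff_integrable_sq hcont.aestronglyMeasurable).2 (by rw [e]; exact hI), ?_⟩
  rw [show (∫ x, dnorm m f x ^ 2) = ∫ x, (fun x => dnorm m f x ^ 2) x from rfl, e]

/-- `|∇^k (∂^β f)|² ≤ |∇^{k+m} f|²` pointwise, for a word `β` of length `m`. [folklore] -/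
theorem dnormSq_ipderiv_le {f : EuclideanSpace ℝ ι → ℝ} (hf : ContDiff ℝ ∞ f) (k : ℕ) {m : ℕ}
    (β : Fin m → ι) (x : EuclideanSpace ℝ ι) : dnormSq k (ipderiv β f) x ≤ dnormSq (k + m) f x := by
  have h := dnorm_ipderiv_le hf k β x
  rw [dnorm, dnorm] at h
  exact (Real.sqrt_le_sqrt_iff (dnormSq_nonneg _ _ _)).1 h

/-- Integrability of `|∇^k (∂^β f)|²` from that of `|∇^{k+m} f|²`. [folklore] -/
theorem integrable_dnormSq_ipderiv {f : EuclideanSpace ℝ ι → ℝ} (hf : ContDiff ℝ ∞ f) (k : ℕ) {m : ℕ}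
    (β : Fin m → ι) (hI : Integrable (dnormSq (k + m) f)) : Integrable (dnormSq k (ipderiv β f)) :=
  hI.mono' (continuous_dnormSq (contDiff_ipderiv hf β) k).aestronglyMeasurable
    (Eventually.of_forall fun x => by
      rw [Real.norm_of_nonneg (dnormSq_nonneg _ _ _)]; exact dnormSq_ipderiv_le hf k β x)

end L2Coord

end Literature.Analysis.FluidPDE

end
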